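import Summits.BirchSwinnertonDyer.Rank1Residual.P2.CongruentNumberEvenAokiMonskyAllPrimes
import Summits.BirchSwinnertonDyer.Rank1Residual.P2.Conjectures.CongruentNumberEvenMonskyLawAtTwo
import HarnessLib

/-!
# Cell `bsd-monsky`: the uniform even doors and the C-P2-2 bookkeeping RUN ON AOKI'S THEOREM 2.2
# (`hAo`, refereed) in place of Monsky's even matrix theorem (`hMe`, printed as a sketch) — every `k`
# (nothing asserted; conditional doors between typed `Prop`s)

HONEST FRAMING (cell `bsd-monsky`, run/shared/lean/pub/bsd-monsky/, README §1: ONE theorem on ONE explicit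
infinite family of quadratic twists of the congruent number curve at the prime `2`; not "BSD for rank ≤ 1",
nothing at odd primes, nothing booked until the cross-family referee passes the written proof). This file
asserts NO arithmetic fact. By `AokiMonsky.card_selmerGroup_two_two_mul_prod_of_aoki` (Aoki = Monsky for
every `k`, `…EvenAokiMonskyAllPrimes.lean`) the `2`-Selmer input `#Sel₂(E_{2p₁⋯p_k}) = 2^{2 + s}` of every
uniform-in-`k` door of the sub-lane's even family can be DISPLAYED as a hypothesis `hSel` on the class
`n ≡ 6 (mod 8)` and DISCHARGED from EITHER named fact; this file does so for

* §1 the uniform even door over census vocabulary (`P2.rankOne_sha_bsdp_two_iff_congruentNumberCurve_two_mul_prod`,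
  binders {GZK, hMe}) → `…_of_selmerSix` (binders {GZK, `hSel`}) and `…_of_aoki` (binders {GZK, hAo});
* §2 the typed uniform law C-P2-2 (`P2/Conjectures/CongruentNumberEvenMonskyLawAtTwo.lean`): its §3
  («observable ⟺ sharper») and §4 (DOOR B6 over census vocabulary; «LAW ⟺ LAW-on-silent-cells») modulo
  {GZK, hAo} (+ U⁺ for §4) instead of {GZK, hMe} — neither conjecture `Prop` is asserted.

`hSel` (displayed, the shape of `HeathBrown1994.monsky_card_selmerGroup_two_even` on `2p₁⋯p_k ≡ 6 (mod 8)`):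
`∀ k p, pᵢ prime → p injective → 2∏pᵢ ≡ 6 (mod 8) → #Sel₂(E_{2∏pᵢ}) = 2^{2 + monskySelmerRankEven p}`;
`hSel` from hAo is `AokiMonsky.monskyEven_six_of_aoki`, from hMe it is one line (§1).

References: [Aoki1999] Thm. 2.2 p. 81; [HeathBrown1994SelmerCongruentII] Appendix (Monsky), typescript
p. 41 L20–L36; [SilvermanAEC2009] Thm. X.4.2; [SilvermanATAEC1994] IV.9.4, Table 4.1; [Miller2011LMS] Def. 1.1;
[TianYuanZhang2017] Thm. 1.2, Thm. 3.5, §1 (1.1); [Monsky1990MockHeegner] Remark (3) p. 67.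
-/

noncomputable section

open scoped Classical

open Matrix WeierstrassCurve Literature.NumberTheory.EllipticCurves
  Literature.NumberTheory.EllipticCurves.Rank1Residual
  Literature.NumberTheory.EllipticCurves.Rank1Residual.Typed
  Literature.NumberTheory.EllipticCurves.HeathBrown1994
  Literature.NumberTheory.EllipticCurves.Aoki1999
  Literature.NumberTheory.EllipticCurves.TianYuanZhang2017

set_option autoImplicit false

namespace Summit.BirchSwinnertonDyer.Rank1Residual.P2

/-! ## §1 The uniform even door with the `2`-Selmer input displayed (`hSel`), from hMe and from hAo -/

section Door

variable {k : ℕ} (p : Fin k → ℕ)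

/-- `hSel` from Monsky's even matrix theorem (one line; «odd primes» is automatic on `n ≡ 6 (mod 8)`).
[cite: HeathBrown1994SelmerCongruentII, Appendix (Monsky), typescript p. 41 L20–L36] -/
theorem selmerSix_of_monskyEven (hMe : monsky_card_selmerGroup_two_even) :
    ∀ (k : ℕ) (p : Fin k → ℕ), (∀ i, (p i).Prime) → Function.Injective p → (2 * ∏ i, p i) % 8 = 6 →
      Nat.card ((congruentNumberCurve (2 * ∏ i, p i)).selmerGroup 2) =
        2 ^ (2 + monskySelmerRankEven p) :=
  fun k p hp hinj h8 => hMe k p hp (AokiMonsky.odd_of_mod_eight_six p h8) hinj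

/-- **THE UNIFORM EVEN DOOR with the `2`-Selmer input DISPLAYED** (`hSel`: `#Sel₂(E_{2p₁⋯p_k}) = 2^{2+s}` on
`n ≡ 6 (mod 8)`), otherwise verbatim `P2.rankOne_sha_bsdp_two_iff_congruentNumberCurve_two_mul_prod`: for distinct
primes with `n = 2p₁⋯p_k ≡ 6 (mod 8)`, `s(n) = 1` and ANY rank-one datum `L′(E_n, 1) = x·Ω·Reg`, `x ≠ 0`:
`ord_{s=1} L = 1`, rank `1` (GZK), `Ш[2^∞] = 0` (`#Sel₂ = 8` + Silverman X.4.2), `BSD(E_n, 2) ⟺ ord₂ x = 2k − 2`.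
[cite: SilvermanAEC2009, Thm. X.4.2] [cite: SilvermanATAEC1994, IV.9.4, Table 4.1 (PDF pp. 345–347)]
[cite: Miller2011LMS, Def. 1.1 (arXiv:1010.2431 p. 3)] -/
theorem rankOne_sha_bsdp_two_iff_congruentNumberCurve_two_mul_prod_of_selmerSix
    (hGZK : rank_eq_analyticRank_of_analyticRank_le_one)
    (hSel : ∀ (k : ℕ) (p : Fin k → ℕ), (∀ i, (p i).Prime) → Function.Injective p →
      (2 * ∏ i, p i) % 8 = 6 →
        Nat.card ((congruentNumberCurve (2 * ∏ i, p i)).selmerGroup 2) =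
          2 ^ (2 + monskySelmerRankEven p))
    (hp : ∀ i, (p i).Prime) (hinj : Function.Injective p) {n : ℕ} (hn : 2 * ∏ i, p i = n)
    (h8 : n % 8 = 6) (hs : monskySelmerRankEven p = 1) {x : ℚ} (hx0 : x ≠ 0)
    (hx : deriv (congruentNumberCurve n).entireLFunction 1 =
      (x : ℂ) * ((congruentNumberCurve n).realPeriodRat : ℂ) *
        ((congruentNumberCurve n).regulator : ℂ)) :
    (congruentNumberCurve n).analyticRank = 1 ∧ (congruentNumberCurve n).mordellWeilRank = 1 ∧
      AddCommGroup.primaryComponent (congruentNumberCurve n).sha 2 = ⊥ ∧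
      (BSDp (congruentNumberCurve n) 2 ↔ padicValRat 2 x = 2 * (k : ℤ) - 2) := by
  have hodd : ∀ i, Odd (p i) := odd_of_two_mul_prod_mod_eight_six p hn h8
  have hsq : Squarefree n := hn ▸ squarefree_two_mul_prod_of_injective p hp hodd hinj
  have hn0 : n ≠ 0 := hsq.ne_zero
  haveI := isElliptic_congruentNumberCurve hn0
  haveI : Fact (Nat.Prime 2) := ⟨Nat.prime_two⟩
  -- root number `−1` and `x ≠ 0`: `ord_{s=1} L = 1` (no named fact)
  have hΩ : ((congruentNumberCurve n).realPeriodRat : ℂ) ≠ 0 := by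
    exact_mod_cast (congruentNumberCurve n).realPeriodRat_pos_holds.ne'
  have hR : ((congruentNumberCurve n).regulator : ℂ) ≠ 0 := by
    exact_mod_cast (congruentNumberCurve n).regulator_pos'.ne'
  have hder : deriv (congruentNumberCurve n).entireLFunction 1 ≠ 0 := by
    rw [hx]
    exact mul_ne_zero (mul_ne_zero (by exact_mod_cast hx0) hΩ) hR
  have hr1 : (congruentNumberCurve n).analyticRank = 1 :=
    analyticRank_congruentNumberCurve_eq_one_of_deriv_ne_zero hsq (Or.inr (Or.inl h8)) hder
  -- GZK: rank `1`; `hSel` + `s(n) = 1`: `#Sel₂ = 8`; hence `Ш[2^∞] = 0`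
  obtain ⟨hrank, -⟩ := hGZK (congruentNumberCurve n) (le_of_eq hr1)
  rw [hr1] at hrank
  have hsel : Nat.card ((congruentNumberCurve n).selmerGroup 2) = 8 := by
    subst hn
    rw [hSel k p hp hinj h8, hs]
    norm_num
  have hbot := primaryComponent_sha_two_eq_bot_of_card_selmerGroup_eq_eight hn0 hrank hsel
  refine ⟨hr1, hrank, hbot, ?_⟩
  rw [bsdp_two_iff_of_LDerivOverOmegaReg_of_sha_two_eq_bot_of_torsionOrder_eq_four
    (congruentNumberCurve n) hGZK hr1 hx hbot (torsionOrder_congruentNumberCurve hsq),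
    tamagawaProduct_congruentNumberCurve_two_mul_prod p hp hodd hinj hn, padicValNat.prime_pow]
  push_cast
  omega

/-- **THE UNIFORM EVEN DOOR modulo {GZK, hAo}** (Aoki's refereed Theorem 2.2 in place of Monsky's even
matrix theorem; every `k`). [cite: Aoki1999, Thm. 2.2 p. 81] [cite: SilvermanAEC2009, Thm. X.4.2]
[cite: Miller2011LMS, Def. 1.1 (arXiv:1010.2431 p. 3)] -/
theorem rankOne_sha_bsdp_two_iff_congruentNumberCurve_two_mul_prod_of_aoki
    (hGZK : rank_eq_analyticRank_of_analyticRank_le_one) (hAo : thm22_card_selmerGroup_two)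
    (hp : ∀ i, (p i).Prime) (hinj : Function.Injective p) {n : ℕ} (hn : 2 * ∏ i, p i = n)
    (h8 : n % 8 = 6) (hs : monskySelmerRankEven p = 1) {x : ℚ} (hx0 : x ≠ 0)
    (hx : deriv (congruentNumberCurve n).entireLFunction 1 =
      (x : ℂ) * ((congruentNumberCurve n).realPeriodRat : ℂ) *
        ((congruentNumberCurve n).regulator : ℂ)) :
    (congruentNumberCurve n).analyticRank = 1 ∧ (congruentNumberCurve n).mordellWeilRank = 1 ∧
      AddCommGroup.primaryComponent (congruentNumberCurve n).sha 2 = ⊥ ∧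
      (BSDp (congruentNumberCurve n) 2 ↔ padicValRat 2 x = 2 * (k : ℤ) - 2) :=
  rankOne_sha_bsdp_two_iff_congruentNumberCurve_two_mul_prod_of_selmerSix p hGZK
    (AokiMonsky.monskyEven_six_of_aoki hAo) hp hinj hn h8 hs hx0 hx

end Door

/-! ## §2 The typed uniform law C-P2-2: §3 and §4 of its file modulo {GZK, hAo} (+ U⁺) -/

namespace Conjectures

/-- **Sharper ⟹ observable at every `k`, modulo {GZK, hAo}.** [cite: Aoki1999, Thm. 2.2 p. 81]
[cite: Miller2011LMS, Def. 1.1 (arXiv:1010.2431 p. 3)] -/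
theorem congruentEvenBSDTwoAt_of_ordTwoAt_of_aoki
    (hGZK : rank_eq_analyticRank_of_analyticRank_le_one) (hAo : thm22_card_selmerGroup_two)
    {k : ℕ} (h : CongruentEvenOrdTwoAt k) : CongruentEvenBSDTwoAt k := by
  intro p hp hinj h8 hs
  obtain ⟨x, hx0, hx, hv⟩ := h p hp hinj h8 hs
  obtain ⟨hr1, -, -, hiff⟩ :=
    rankOne_sha_bsdp_two_iff_congruentNumberCurve_two_mul_prod_of_aoki p hGZK hAo hp hinj rfl h8 hs hx0 hx
  exact ⟨hr1, hiff.mpr hv⟩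

/-- **Observable ⟹ sharper at every `k`, modulo {GZK, hAo}** (verbatim the hMe proof with `#Sel₂ = 2^{2+s}`
read off Aoki's theorem through `AokiMonsky.card_selmerGroup_two_two_mul_prod_of_aoki`).
[cite: Aoki1999, Thm. 2.2 p. 81] [cite: Miller2011LMS, §1 and Def. 1.1 (arXiv:1010.2431 p. 3)]
[cite: SilvermanAEC2009, Thm. X.4.2] [cite: SilvermanATAEC1994, IV.9.4, Table 4.1] -/
theorem congruentEvenOrdTwoAt_of_bsdTwoAt_of_aoki
    (hGZK : rank_eq_analyticRank_of_analyticRank_le_one) (hAo : thm22_card_selmerGroup_two)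
    {k : ℕ} (h : CongruentEvenBSDTwoAt k) : CongruentEvenOrdTwoAt k := by
  intro p hp hinj h8 hs
  have hodd : ∀ i, Odd (p i) := odd_of_two_mul_prod_mod_eight_six p rfl h8
  have hsq : Squarefree (2 * ∏ i, p i) := squarefree_two_mul_prod_of_injective p hp hodd hinj
  have hn0 : 2 * ∏ i, p i ≠ 0 := hsq.ne_zero
  haveI := isElliptic_congruentNumberCurve hn0
  haveI : Fact (Nat.Prime 2) := ⟨Nat.prime_two⟩
  obtain ⟨hr1, hbsd⟩ := h p hp hinj h8 hs
  obtain ⟨-, -, y, hy, hval⟩ := hbsd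
  obtain ⟨hrank, -⟩ := hGZK (congruentNumberCurve (2 * ∏ i, p i)) (le_of_eq hr1)
  rw [hr1] at hrank
  have hsel : Nat.card ((congruentNumberCurve (2 * ∏ i, p i)).selmerGroup 2) = 8 := by
    rw [AokiMonsky.card_selmerGroup_two_two_mul_prod_of_aoki hAo p hp hinj h8, hs]
    norm_num
  have hbot := primaryComponent_sha_two_eq_bot_of_card_selmerGroup_eq_eight hn0 hrank hsel
  have hcard : Nat.card
      (AddCommGroup.primaryComponent (congruentNumberCurve (2 * ∏ i, p i)).sha 2) = 1 := by
    rw [hbot]; exact AddSubgroup.card_bot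
  rw [hcard, padicValNat_one_right, Nat.cast_zero] at hval
  obtain ⟨hlead, hder⟩ := leadingLCoeff_eq_deriv_of_analyticRank_eq_one hr1
  have hT := torsionOrder_congruentNumberCurve hsq
  have htam : (congruentNumberCurve (2 * ∏ i, p i)).tamagawaProduct = 2 ^ (2 * k + 2) :=
    tamagawaProduct_congruentNumberCurve_two_mul_prod p hp hodd hinj rfl
  have hΩ : ((congruentNumberCurve (2 * ∏ i, p i)).realPeriodRat : ℂ) ≠ 0 := by
    exact_mod_cast (congruentNumberCurve (2 * ∏ i, p i)).realPeriodRat_pos_holds.ne'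
  have hR : ((congruentNumberCurve (2 * ∏ i, p i)).regulator : ℂ) ≠ 0 := by
    exact_mod_cast (congruentNumberCurve (2 * ∏ i, p i)).regulator_pos'.ne'
  have h2 : (2 : ℂ) ^ (2 * k + 2) ≠ 0 := pow_ne_zero _ two_ne_zero
  have hsha := hy
  rw [shaAn_def, hlead, hT, htam] at hsha
  push_cast at hsha
  have hderiv : deriv (congruentNumberCurve (2 * ∏ i, p i)).entireLFunction 1 =
      ((y * 2 ^ (2 * k + 2) / 16 : ℚ) : ℂ) *
        ((congruentNumberCurve (2 * ∏ i, p i)).realPeriodRat : ℂ) *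
          ((congruentNumberCurve (2 * ∏ i, p i)).regulator : ℂ) := by
    rw [div_eq_iff (mul_ne_zero (mul_ne_zero hΩ h2) hR)] at hsha
    push_cast
    linear_combination (1 / 16 : ℂ) * hsha
  have hy0 : y ≠ 0 := by
    rintro rfl
    apply hder
    rw [hderiv]; push_cast; ring
  have hy2 : y * 2 ^ (2 * k + 2) ≠ 0 := mul_ne_zero hy0 (pow_ne_zero _ two_ne_zero)
  refine ⟨y * 2 ^ (2 * k + 2) / 16, div_ne_zero hy2 (by norm_num), hderiv, ?_⟩
  rw [padicValRat.div hy2 (by norm_num), padicValRat.mul hy0 (pow_ne_zero _ two_ne_zero), hval,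
    show ((2 : ℚ) ^ (2 * k + 2)) = ((2 ^ (2 * k + 2) : ℕ) : ℚ) by push_cast; rfl,
    show (16 : ℚ) = ((2 ^ 4 : ℕ) : ℚ) by norm_num, padicValRat.of_nat, padicValRat.of_nat,
    padicValNat.prime_pow, padicValNat.prime_pow]
  push_cast
  ring

/-- **C-P2-2 at `k` primes: observable ⟺ sharper, modulo {GZK, hAo}.** Neither side is asserted.
[cite: Aoki1999, Thm. 2.2 p. 81] [cite: Miller2011LMS, Def. 1.1 (arXiv:1010.2431 p. 3)] -/
theorem congruentEvenBSDTwoAt_iff_ordTwoAt_of_aoki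
    (hGZK : rank_eq_analyticRank_of_analyticRank_le_one) (hAo : thm22_card_selmerGroup_two) {k : ℕ} :
    CongruentEvenBSDTwoAt k ↔ CongruentEvenOrdTwoAt k :=
  ⟨congruentEvenOrdTwoAt_of_bsdTwoAt_of_aoki hGZK hAo, congruentEvenBSDTwoAt_of_ordTwoAt_of_aoki hGZK hAo⟩

/-- **C-P2-2, uniform: `CongruentEvenMonskyBSDTwo ⟺ CongruentEvenMonskyOrdTwo`, modulo {GZK, hAo}.**
Neither conjecture is asserted. [cite: Aoki1999, Thm. 2.2 p. 81] [cite: Miller2011LMS, Def. 1.1] -/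
theorem congruentEvenMonskyBSDTwo_iff_ordTwo_of_aoki
    (hGZK : rank_eq_analyticRank_of_analyticRank_le_one) (hAo : thm22_card_selmerGroup_two) :
    CongruentEvenMonskyBSDTwo ↔ CongruentEvenMonskyOrdTwo :=
  ⟨fun h k hk => congruentEvenOrdTwoAt_of_bsdTwoAt_of_aoki hGZK hAo (h k hk),
    fun h k hk => congruentEvenBSDTwoAt_of_ordTwoAt_of_aoki hGZK hAo (h k hk)⟩

section Rule

variable (hU : ∀ (n : ℕ), Squarefree n → (n % 8 = 5 ∨ n % 8 = 6 ∨ n % 8 = 7) →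
      ∃ L : ℤ, IsScriptL n L ∧
        ((n % 8 = 5 ∨ n % 8 = 7) → (2 : ℤ) ∣ L →
          Even (genusSum₁ n fun d => genusClassNumber (GenusField d)) ∧
          Even (genusSum₂' n fun d => genusClassNumber (GenusField d))) ∧
        (n % 8 = 6 → (2 : ℤ) ∣ L → Even (genusSum₂' n fun d => genusClassNumber (GenusField d))))
include hU

/-- **DOOR B6 OVER CENSUS VOCABULARY modulo {U⁺, GZK, hAo}** (the LOUD cells are theorems): verbatim
`rankOne_sha_bsdp_two_congruentNumberCurve_two_mul_prod_of_odd_genusSum₂'` with the uniform door run on hAo.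
[cite: TianYuanZhang2017, Thm. 1.2, Thm. 3.5 and §1 (1.1)] [cite: Aoki1999, Thm. 2.2 p. 81]
[cite: Miller2011LMS, Def. 1.1 (arXiv:1010.2431 p. 3)] -/
theorem rankOne_sha_bsdp_two_congruentNumberCurve_two_mul_prod_of_odd_genusSum₂'_of_aoki
    (hGZK : rank_eq_analyticRank_of_analyticRank_le_one) (hAo : thm22_card_selmerGroup_two)
    {k : ℕ} (p : Fin k → ℕ) (hp : ∀ i, (p i).Prime) (hinj : Function.Injective p) {n : ℕ}
    (hn : 2 * ∏ i, p i = n) (h8 : n % 8 = 6) (hs : monskySelmerRankEven p = 1)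
    (hgen : Odd (genusSum₂' n fun d => genusClassNumber (GenusField d))) :
    (congruentNumberCurve n).analyticRank = 1 ∧ (congruentNumberCurve n).mordellWeilRank = 1 ∧
      AddCommGroup.primaryComponent (congruentNumberCurve n).sha 2 = ⊥ ∧
      BSDp (congruentNumberCurve n) 2 := by
  have hodd : ∀ i, Odd (p i) := odd_of_two_mul_prod_mod_eight_six p hn h8
  have hsq : Squarefree n := hn ▸ squarefree_two_mul_prod_of_injective p hp hodd hinj
  obtain ⟨L, hLodd, -, hderiv⟩ := rankOneDatum_of_uPlus_six hU hsq h8 hgen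
  have hL0 : (L : ℚ) ≠ 0 := by
    have hL0' : L ≠ 0 := fun h => by simp [h] at hLodd
    exact_mod_cast hL0'
  have hx0 : (2 : ℚ) ^ twoExponent n * (L : ℚ) ^ 2 ≠ 0 :=
    mul_ne_zero (zpow_ne_zero _ two_ne_zero) (pow_ne_zero _ hL0)
  have hx : deriv (congruentNumberCurve n).entireLFunction 1 =
      (((2 : ℚ) ^ twoExponent n * (L : ℚ) ^ 2 : ℚ) : ℂ) *
        ((congruentNumberCurve n).realPeriodRat : ℂ) * ((congruentNumberCurve n).regulator : ℂ) := by
    rw [hderiv]; push_cast; ring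
  obtain ⟨hr1, hrank, hbot, hiff⟩ :=
    rankOne_sha_bsdp_two_iff_congruentNumberCurve_two_mul_prod_of_aoki p hGZK hAo hp hinj hn h8 hs hx0 hx
  refine ⟨hr1, hrank, hbot, hiff.mpr ?_⟩
  rw [padicValRat_two_zpow_mul_sq hLodd, ← hn, twoExponent_two_mul_prod_eq p hp hodd hinj]

/-- **LAW ⟺ LAW-ON-SILENT-CELLS at every `k`, modulo {U⁺, GZK, hAo}.** Asserts neither side.
[cite: TianYuanZhang2017, Thm. 1.2, Thm. 3.5] [cite: Aoki1999, Thm. 2.2 p. 81] [cite: Miller2011LMS, Def. 1.1] -/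
theorem congruentEvenBSDTwoAt_iff_silent_of_aoki
    (hGZK : rank_eq_analyticRank_of_analyticRank_le_one) (hAo : thm22_card_selmerGroup_two) {k : ℕ} :
    CongruentEvenBSDTwoAt k ↔ CongruentSilentEvenBSDTwoAt k := by
  refine ⟨congruentSilentEvenBSDTwoAt_of_bsdTwoAt, fun h p hp hinj h8 hs => ?_⟩
  rcases Nat.even_or_odd (genusSum₂' (2 * ∏ i, p i) fun d => genusClassNumber (GenusField d)) with
    hev | hod
  · exact h p hp hinj h8 hs hev
  · obtain ⟨hr1, -, -, hb⟩ :=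
      rankOne_sha_bsdp_two_congruentNumberCurve_two_mul_prod_of_odd_genusSum₂'_of_aoki hU hGZK hAo p hp
        hinj rfl h8 hs hod
    exact ⟨hr1, hb⟩

/-- **Uniform form of the rule modulo {U⁺, GZK, hAo}:** `CongruentEvenMonskyBSDTwo ⟺ ∀ k ≥ 2`, the silent
restriction. Asserts neither. [cite: TianYuanZhang2017, Thm. 1.2] [cite: Aoki1999, Thm. 2.2 p. 81] -/
theorem congruentEvenMonskyBSDTwo_iff_forall_silent_of_aoki
    (hGZK : rank_eq_analyticRank_of_analyticRank_le_one) (hAo : thm22_card_selmerGroup_two) :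
    CongruentEvenMonskyBSDTwo ↔ ∀ k : ℕ, 2 ≤ k → CongruentSilentEvenBSDTwoAt k :=
  ⟨fun h k hk => congruentSilentEvenBSDTwoAt_of_bsdTwoAt (h k hk),
    fun h k hk => (congruentEvenBSDTwoAt_iff_silent_of_aoki hU hGZK hAo).mpr (h k hk)⟩

end Rule

end Conjectures

end Summit.BirchSwinnertonDyer.Rank1Residual.P2

end
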